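import Summits.HodgeConjecture.HodgeConjecture.Theorems.F0P3cStCharTSTransferChecklist   -- ★ p849876 (this seat) the TRANSFER third
import Summits.HodgeConjecture.HodgeConjecture.Theorems.F0P3cStCharTSVirtualJacquetOfXIGEx  -- ★ the organ's cone (every notion of the XIG′ binders)
import Summits.HodgeConjecture.HodgeConjecture.Theorems.F0P3cStCharTSHfHonOfSum              -- ★ p849886
import Summits.HodgeConjecture.HodgeConjecture.Theorems.F0P3cStCharTSCharTrivialNhds         -- ★ p849929 the `U` device
import Summits.HodgeConjecture.HodgeConjecture.Theorems.F0P3cStCharTSGShellData               -- ★ p849915 (G1)(G2)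
import Summits.HodgeConjecture.HodgeConjecture.Theorems.F0P3cStCharTSCassHTraceKit            -- ★ `dominant_central_mul_pow` (dominance of `b = z·aᵐ` from the package clauses)
import Summits.HodgeConjecture.HodgeConjecture.Theorems.F0P3cStCharTSA2Ray                    -- ★ (LH5-p05) the H-ray `a₂` with `E₂ a₂ = d(α, (σα)⁻¹)`
import Summits.HodgeConjecture.HodgeConjecture.Theorems.F0P3cCMBorelIwahoriDatumU2Inst      -- ★ p850065 (LH4-p02) the H-datum package `exists_cmIwahoriDatum₂`
import Summits.HodgeConjecture.HodgeConjecture.Theorems.F0P3cStCharTSK0WeylG                 -- ★ p850013 (LH5-p05) Weyl elements in `K₀` ∕ `hKw` (N = 3, 2)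
import Summits.HodgeConjecture.HodgeConjecture.Theorems.F0P3cStCharTSK0WeylGHiff             -- ★ p850093 (A-p16) F1-G `hiff` from the package clauses
import Summits.HodgeConjecture.HodgeConjecture.Theorems.F0P3cStCharTSDomGeneralHPkg          -- ★ p850025∕p850121 (A-p16) `domGeneralH_of_inst` (F1-H dominance at every H-dominant `t`)
import Summits.HodgeConjecture.HodgeConjecture.Theorems.F0P3cStCharTSHtauOnCoset             -- ★ p849908 (LH6-p03) the μ-level `nμ` (`exists_level_hτ_of_smul_cosets`)
import Summits.HodgeConjecture.HodgeConjecture.Theorems.F0P3cStCharTSLevelPickInst           -- ★ p850088 (LH4-p02) `exists_level_K₁_box_pick_subgroup`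
import Summits.HodgeConjecture.HodgeConjecture.Theorems.F0P3cStCharTSXIGData                 -- ★ (LH6-p03) `exists_xigData` (w₀, b′, Sn, F)
import Summits.HodgeConjecture.HodgeConjecture.Theorems.F0P3cStCharTSConstants               -- ★ p850071 (F0P2-p06) `hval_of_div`, `kappaG_ne_zero`, `kappaH_ne_zero`
import Summits.HodgeConjecture.HodgeConjecture.Theorems.F0P3cStCharTSTestFunctionSum         -- ★ p849729 `isLocSmooth_doubleCosetSum`
import Literature.NumberTheory.Rogawski1990.SingularLocalOrbitSeparationOpenPos               -- ★ `isLocSmooth_indicator_of_isOpen_isCompact`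
import Summits.HodgeConjecture.HodgeConjecture.Theorems.F0P3cStCharTSXiCont                  -- ★ p850203 (F0P3-p01) «XI-CONT + M-NONARCH»
import Summits.HodgeConjecture.HodgeConjecture.Theorems.F0P3cStCharTSHfHonOfFH0              -- ★ p850120 (LH4-p02) `hfHon_fH0`
import Summits.HodgeConjecture.HodgeConjecture.Theorems.F0P3cStCharTSHogOfGValue             -- ★ p850178 (F0P3-p01) `hOG_indicator_shell`, set bridges
import Summits.HodgeConjecture.HodgeConjecture.Theorems.F0P3cStCharTSRepHyperbolic           -- ★ p850107 (F0P3-p01) `forall_rep_hyperbolic_of_cover`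
import Summits.HodgeConjecture.HodgeConjecture.Theorems.F0P3cStCharTSHKSpellings             -- ★ p850085 (LH6-p02) `hKr_of_hK`, `exists_glDiagonal_shellPoint`
import Summits.HodgeConjecture.HodgeConjecture.Theorems.F0P3cStCharTSHorient                 -- ★ p849911 (LH1-p03) `horient_antiShell`
import Literature.NumberTheory.Automorphic.ValuedFieldValuativeRelBridge                     -- ★ `v_le_iff_valuation_le`
import Summits.HodgeConjecture.HodgeConjecture.Theorems.F0P3cStCharTSXIGHPackage             -- p850442 (this seat) the H-PACKAGE: `hPackageH` (∘ ★ p850340 ∘ ★ p850219 ∘ ★ p850188 ∘ ★ p850152 ∘ ★ p849815)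
import Summits.HodgeConjecture.HodgeConjecture.Theorems.F0P3cStCharTSShellOn                 -- ★ (F0P2-p02) `hflip_of_antiOriented`
import Summits.HodgeConjecture.HodgeConjecture.Theorems.F0P3cStCharTSValueAtFlips           -- ★ p850420 (LH6-p02 (g3)) «VALUE-AT-FLIPS»: `smoothTrace_fH0_eq_mul_cmXiTorusChar_of_oriented`, `isOpen_ker_psi_comp_localDet`
import Summits.HodgeConjecture.HodgeConjecture.Theorems.F0P3cStCharTSValueRatios            -- ★ p850493 (LH6-p02 (g3)) «VALUE-RATIOS»: `exists_value_ratios` (hAG hAH hrH hcard)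
import Summits.HodgeConjecture.HodgeConjecture.Theorems.F0P3cStCharTSHLevelDeep             -- ★ p850484 (A-p16 (g34)) «JACQUET-DATUM-H ∕ H-LEVEL-DEEP»: `exists_deep_level_cm`, `forall_mem_of_refine`, `continuous_chiH2_fst`, `hiff_chiH2`; brings ★ HTR-AT-REPS, ★ W2-c
import Summits.HodgeConjecture.HodgeConjecture.Theorems.F0P3cStCharTSXIGDataFlip            -- ★ p850337 (LH6-p03 (g2)) «FLIP-REP»: `forall_exists_mem_smul_flip_of_cover`
import Summits.HodgeConjecture.HodgeConjecture.Theorems.F0P3cStCharTSHaarProdSplit          -- ★ p850050 (LH6-p02 (g2)) «HAAR-PROD-SPLIT»: `measurableSpace_cmH_eq_prod`, `exists_haar_prod_eq_cmH`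
import HarnessLib

/-!
# F0 · P3c · line LH6 «StCharTS» — road (D) «DEEP-FL» HEAD: the organ (S-X)′ = XIG′ of the LH6 pay-down leaf, PROVED — for the deep shell `K_n (z·aᵐ) K_n` of
# `U(Φ₃)(L⁺_v)` at a non-split place there is an endoscopic test function `f^H₀ = Σ_u c_u 𝟙_{K_H u K_H}` on `U(Φ₂)×U(Φ₁)` which is smooth, is a `Δ`-TRANSFER of
# `𝟙_{K_n (z aᵐ) K_n}`, and has `Tr St_H(ξ_v)(f^H₀) = ν(K_n)·#R·δ_B^{1∕2}(z aᵐ)·χ_ξ(z aᵐ)` [Rogawski1990, §12.7 Lemma 12.7.3 (proof) p. 195; §4.9 p. 54–56; §12.1–12.2 pp. 171–174]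

Cell `pub/hodgecm-mathlib`, crux H413 = `stmt-HodgeConjecture-24833` (lane `--supports … --as helper`), route HCCMUnconditional.  THE HEAD OF ROAD (D): statement =
the organ `stub_StXIGSt` of the LH6 leaf `Cruxes/H413/Lines/F0_P3c_StCharTSPaydown.lean` ED. 8 «(S-X) RE-LETTERED» VERBATIM (XIG′ text v3 8370ced9a3c5de43: the XIG ∃-form with
the (T1) package clauses of ★ `exists_cmIwahoriDatum` as hypotheses), so the leaf edition «(S-X) IN» is the one-liner `stub_StXIGSt := F0P3cStCharTSXIGAssembly.stXIGSt'`
(leaf sorries 3 → 2).  Authorship: skeleton + data steps A-p16 (g34) (v3∕v3b), transfer slots LH6-p04 (g3) (v3c∕v3e, owner of record until 08:34Z), deep H-level (J3) A-p16,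
value wiring LH6-p02 (g3) (v3f-value); filed by the road (D) owner of record A-p16 (g34) (desk F0P3-plan (g15) D82).  THEOREMS ONLY (one theorem, no definition, no
instance, no notation, no named fact, no `sorry`); ★-only imports.  HONEST LABEL: count-neutral by itself — (S-X) is paid in-house only when the leaf edition «(S-X) IN»
lands; HC_CM is proved only modulo the 7 printed citations (2 remaining: hLiu418 = stmt-HodgeConjecture-24832, h413 = stmt-HodgeConjecture-24833) until rung 0 closes.

THE PROOF (every input ★, consumed BY NAME).  STEP U: the neighbourhood `U := U_level ∩ U_ξ` (★ G-SHELL-DATA, ★ CharTrivialNhds at `χ_ξ`, ★ XI-CONT∕M-NONARCH).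
(1) `z ∈ T₃`, dominance of `b = z·aᵐ` at every level (★ `CassHTraceKit.dominant_central_mul_pow`), F1-G `hiff` (★ K0WeylGHiff); (2) canonical ⇒ admissible orbital families;
(3) the H-datum along `d(α,(σα)⁻¹)` (★ A2Ray, ★ U2-Inst `exists_cmIwahoriDatum₂`, ★ K0WeylG, ★ DomGeneralHPkg `domGeneralH_of_inst`); (4) the μ-level (★ HTAU-ON-COSET),
the H-level pick (★ LEVEL-PICK-INST) DEEPENED by ★ H-LEVEL-DEEP (`ξ_v = 1` on `K_H`, `ψ_v∘det = 1` on `K₁`, `χ_{H,2} = 1` on `T₂ ∩ K_{2,n′}`), `S′ = (T₂ ∩ K_{2,n′}) × K₁`;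
(5) ★ XIG-DATA (`w₀, b′, S_n, F`), ★ REP-HYPERBOLIC, ★ HK2; (6) `f^H₀ := Σ_{u∈F} c_u 𝟙_{K_H (u₁,u₂) K_H}`: SMOOTH (★ TestFunctionSum); TRANSFER by ★ p849876
`isLocalDeltaTransfer_doubleCosetSum_of_checklist` with `hfHon` (★ HFHON-OF-FH0 + ★ HK2-OF-INST), `hOG` (★ HOG-OF-GVALUE + ★ HKSpellings∕B-DIAG), `hOHj` (★ H-PACKAGE
`hPackageH`), `horient` (★ HORIENT), `hflip` (★ ShellOn + ★ FLIP-DOMINANT), `hcov∕hsub∕hC` (★ XIG-DATA), `hτ` (★ HTAU-ON-COSET), `hval` (★ CONSTANTS); VALUE by ★ VALUE-AT-FLIPS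
`smoothTrace_fH0_eq_mul_cmXiTorusChar_of_oriented` over ★ HAAR-PROD-SPLIT, ★ VALUE-RATIOS, ★ HTR-AT-REPS (Jacquet datum ★ W2-c at ★ `continuous_chiH2_fst`, `hiff` ★ `hiff_chiH2`,
`hdom` ★ FLIP-DOMINANT), ★ FLIP-REP.

## References
* [Rogawski1990] J. D. Rogawski, *Automorphic Representations of Unitary Groups in Three Variables*, Ann. of Math. Stud. 123 (1990): §4.3 (4.3.1) p. 43; §4.9 Prop. 4.9.1,
  Lemma 4.9.2 pp. 54–56; §12.1 pp. 171–172; §12.2 pp. 173–174; §12.7 Lemma 12.7.3 (proof) p. 195.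
* [Casselman1995] W. Casselman, *Introduction to the theory of admissible representations of 𝔭-adic reductive groups* (1995 notes), §1.4 Prop. 1.4.4 p. 14; Thm. 3.3.3; L. 7.1.1.
* [vanDijk1972] G. van Dijk, *Computation of certain induced characters of 𝔭-adic groups*, Math. Ann. 199 (1972), Thm. p. 237.
-/

set_option autoImplicit false
set_option linter.dupNamespace false
noncomputable section
open NumberField IsDedekindDomain MeasureTheory Topology Filter
open scoped Matrix MatrixGroups WithZero Pointwise
open Literature.NumberTheory Literature.NumberTheory.Automorphic Literature.NumberTheory.Automorphic.UnitaryGroup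
open Literature.NumberTheory.GaloisRepresentations
open Literature.NumberTheory.Rogawski1990

namespace Summit.HodgeConjecture.HodgeConjecture.Cruxes.H413.F0P3cStCharTSXIGAssembly

set_option maxHeartbeats 16000000 in
set_option synthInstance.maxHeartbeats 400000 in
/-- **THE (S-X)′ ORGAN «XIG′» OF THE LH6 LEAF, PROVED** (text = `stub_StXIGSt` of `Cruxes/H413/Lines/F0_P3c_StCharTSPaydown.lean` ED. 8 VERBATIM): at a finite place `v` of `L⁺`
non-split in `L`, for the XIG Iwahori package `(𝓘, K₀)` of `U(Φ₃)(L⁺_v)` along the ray `d(α,1,(σα)⁻¹)`, a central `z`, there is `U ∈ 𝓝 1` such that for every level `K_n ⊆ U`, every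
`m ≥ 1` and every left transversal `R` of `K_n ∕ (K_n ∩ ᵇK_n)` (`b = z aᵐ ∈ T₃`), some `f^H ∈ C_c^∞(U(Φ₂)×U(Φ₁))` is a `Δ`-transfer of `𝟙_{K_n b K_n}` with
`Tr St_H(ξ_v)(f^H) = ν_Q(K_n)·#R·δ_B^{1∕2}(b)·χ_ξ(b)`. [cite: Rogawski1990, §12.7 Lemma 12.7.3 (proof) p. 195; §4.9 Lemma 4.9.2 p. 56; §12.1 pp. 171–172] [cite: Casselman1995, Prop. 1.4.4 p. 14]
[cite: vanDijk1972, Thm. p. 237] -/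
theorem stXIGSt' :
      ∀ (L : Type) [Field L] [NumberField L] [IsCMField L] (μ : HeckeCharacter L) (ξ : OneDimAutRepH L) (v : HeightOneSpectrum (𝓞 ↥(maximalRealSubfield L))),
        (∀ w : PlacesOver L v, IsCMField.complexConj L • w.1 = w.1) → μ.IsUnitary →
        (∀ x : Literature.NumberTheory.GaloisRepresentations.ideleGroup ↥(maximalRealSubfield L),
          μ (AdeleRing.ideleBaseChange (↥(maximalRealSubfield L)) L x) = quadraticHeckeCharCM L x) →
        ∀ [MeasurableSpace (((UnitaryGroup.cmDatum L 2 (Matrix.of fun i j : Fin 2 => if i.val + j.val + 1 = 2 then (1 : L) else 0)).Local v × (UnitaryGroup.cmDatum L 1 (Matrix.of fun i j : Fin 1 => if i.val + j.val + 1 = 1 then (1 : L) else 0)).Local v))] [BorelSpace (((UnitaryGroup.cmDatum L 2 (Matrix.of fun i j : Fin 2 => if i.val + j.val + 1 = 2 then (1 : L) else 0)).Local v × (UnitaryGroup.cmDatum L 1 (Matrix.of fun i j : Fin 1 => if i.val + j.val + 1 = 1 then (1 : L) else 0)).Local v))] [MeasurableSpace (Gqs L v)] [BorelSpace (Gqs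 L v)]
          (νHv : Measure (((UnitaryGroup.cmDatum L 2 (Matrix.of fun i j : Fin 2 => if i.val + j.val + 1 = 2 then (1 : L) else 0)).Local v × (UnitaryGroup.cmDatum L 1 (Matrix.of fun i j : Fin 1 => if i.val + j.val + 1 = 1 then (1 : L) else 0)).Local v))) (νQv : Measure (Gqs L v))
          [νHv.IsHaarMeasure] [νHv.IsMulRightInvariant] [νQv.IsHaarMeasure] [νQv.IsMulRightInvariant],
        letI : ∀ a : ((UnitaryGroup.cmDatum L 2 (Matrix.of fun i j : Fin 2 => if i.val + j.val + 1 = 2 then (1 : L) else 0)).Local v × (UnitaryGroup.cmDatum L 1 (Matrix.of fun i j : Fin 1 => if i.val + j.val + 1 = 1 then (1 : L) else 0)).Local v), MeasurableSpace (((UnitaryGroup.cmDatum L 2 (Matrix.of fun i j : Fin 2 => if i.val + j.val + 1 = 2 then (1 : L) else 0)).Local v × (UnitaryGroup.cmDatum L 1 (Matrix.of fun i j : Fin 1 => if i.val + j.val + 1 = 1 then (1 : L) else 0)).Local v) ⧸ Subgroup.centralizer ({a} : Set (((UnitaryGroup.cmDatum L 2 (Matrix.of fun i j : Fin 2 =>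 if i.val + j.val + 1 = 2 then (1 : L) else 0)).Local v × (UnitaryGroup.cmDatum L 1 (Matrix.of fun i j : Fin 1 => if i.val + j.val + 1 = 1 then (1 : L) else 0)).Local v)))) := fun _ => borel _
        haveI : ∀ a : ((UnitaryGroup.cmDatum L 2 (Matrix.of fun i j : Fin 2 => if i.val + j.val + 1 = 2 then (1 : L) else 0)).Local v × (UnitaryGroup.cmDatum L 1 (Matrix.of fun i j : Fin 1 => if i.val + j.val + 1 = 1 then (1 : L) else 0)).Local v), BorelSpace (((UnitaryGroup.cmDatum L 2 (Matrix.of fun i j : Fin 2 => if i.val + j.val + 1 = 2 then (1 : L) else 0)).Local v × (UnitaryGroup.cmDatum L 1 (Matrix.of fun i j : Fin 1 => if i.val + j.val + 1 = 1 then (1 : L) else 0)).Local v) ⧸ Subgroup.centralizer ({a} : Set (((UnitaryGroup.cmDatum L 2 (Matrix.of fun i j : Fin 2 => if i.val + j.val + 1 = 2 then (1 : L) else 0)).Local v × (UnitaryGroup.cmDatum L 1 (Matrix.of fun i j : Fin 1 => if i.val + j.val + 1 = 1 then (1 : L) else 0)).Local v)))) := fun _ => ⟨rfl⟩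
        letI : ∀ γ : Gqs L v, MeasurableSpace (Gqs L v ⧸ Subgroup.centralizer ({γ} : Set (Gqs L v))) := fun _ => borel _
        haveI : ∀ γ : Gqs L v, BorelSpace (Gqs L v ⧸ Subgroup.centralizer ({γ} : Set (Gqs L v))) := fun _ => ⟨rfl⟩
        ∀ (mHv : OrbitalMeasureFamily (((UnitaryGroup.cmDatum L 2 (Matrix.of fun i j : Fin 2 => if i.val + j.val + 1 = 2 then (1 : L) else 0)).Local v × (UnitaryGroup.cmDatum L 1 (Matrix.of fun i j : Fin 1 => if i.val + j.val + 1 = 1 then (1 : L) else 0)).Local v))) (mQv : OrbitalMeasureFamily (Gqs L v)),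
          mHv.IsCanonical (IsLocalGRegular L v) νHv →
          mQv.IsCanonical (fun γ => IsRegularElt (γ.val : GL (Fin 3) (UnitaryGroup.LocalRing L v))) νQv →
          IsLocalDeltaTransferExists L (qsForm L) v ((finExplicitCollection L (qsForm L) μ (finExplicitDelta_conj_left_all L (qsForm L) μ) (finExplicitDelta_conj_right_all L (qsForm L) μ)) v) mHv mQv IsLocSmooth IsLocSmooth →
          ∀ (π₁ πSt : IrrClass (((UnitaryGroup.cmDatum L 2 (Matrix.of fun i j : Fin 2 => if i.val + j.val + 1 = 2 then (1 : L) else 0)).Local v × (UnitaryGroup.cmDatum L 1 (Matrix.of fun i j : Fin 1 => if i.val + j.val + 1 = 1 then (1 : L) else 0)).Local v))),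
            HLengthTwoLabels L v
              (torusCharPair (conjLocal L (IsCMField.complexConj L) v) (cmLocalForm L 2 v) (cmLocalForm_eq_over L 2 v) 0
                ((torusLocalComponent L (IsCMField.complexConj L) v ξ.η).comp
                    (quotConj (conjLocal L (IsCMField.complexConj L) v) (conjLocal_conjLocal_cm L v)) *
                  halfModulusChar (UnitaryGroup.LocalRing L v))
                (torusLocalComponent L (IsCMField.complexConj L) v ξ.ψ))
              ((torusLocalComponent L (IsCMField.complexConj L) v ξ.ψ).comp (localDet (IsCMField.complexConj L) v (isUnit_antidiagOne_det L 1))) π₁ πSt →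
            (∀ fH : ((UnitaryGroup.cmDatum L 2 (Matrix.of fun i j : Fin 2 => if i.val + j.val + 1 = 2 then (1 : L) else 0)).Local v × (UnitaryGroup.cmDatum L 1 (Matrix.of fun i j : Fin 1 => if i.val + j.val + 1 = 1 then (1 : L) else 0)).Local v) → ℂ, IsLocSmooth fH → π₁.smoothTrace νHv fH = charDist (ξ.xiLocalChar v) νHv fH) →
          haveI := locallyCompactSpace_cmBorelU L 3 v
          ∀ (𝓘 : (cmBorelTriple L 3 v).IwahoriDatum) (z : ↥(unitaryGroupOfForm (conjLocal L (IsCMField.complexConj L) v) (cmLocalForm L 3 v))),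
            z ∈ Subgroup.center ↥(unitaryGroupOfForm (conjLocal L (IsCMField.complexConj L) v) (cmLocalForm L 3 v)) →
          ∀ (w : PlacesOver L v) (hw : IsCMField.complexConj L • w.1 = w.1) (α : w.1.adicCompletion L), α ≠ 0 → Valued.v α < 1 →
            ((((localNonsplitEquiv (IsCMField.complexConj L) (Rogawski1990.qsForm L) (IsCMField.complexConj_ne_one L) w hw) 𝓘.a : ↥(unitaryGroupOfForm (galAdicCompletionMap (L := L) (IsCMField.complexConj L) hw) (placeForm (Rogawski1990.qsForm L) w.1))) :
                GL (Fin 3) (w.1.adicCompletion L)) : Matrix (Fin 3) (Fin 3) (w.1.adicCompletion L)) = Matrix.diagonal ![α, 1, ((galAdicCompletionMap (L := L) (IsCMField.complexConj L) hw) α)⁻¹] →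
            ∀ (K₀ : Subgroup ↥(unitaryGroupOfForm (conjLocal L (IsCMField.complexConj L) v) (cmLocalForm L 3 v))),
            IsCompact (K₀ : Set ↥(unitaryGroupOfForm (conjLocal L (IsCMField.complexConj L) v) (cmLocalForm L 3 v))) → IsOpen (K₀ : Set ↥(unitaryGroupOfForm (conjLocal L (IsCMField.complexConj L) v) (cmLocalForm L 3 v))) →
            Subgroup.center ↥(unitaryGroupOfForm (conjLocal L (IsCMField.complexConj L) v) (cmLocalForm L 3 v)) ≤ K₀ → (∀ n, 𝓘.K n ≤ K₀) →
            (∀ n, ∀ k ∈ K₀, ∀ κ ∈ 𝓘.K n, k⁻¹ * κ * k ∈ 𝓘.K n) →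
            (∀ n, ∀ x ∈ 𝓘.K n ⊓ (cmBorelTriple L 3 v).N, 𝓘.a * x * 𝓘.a⁻¹ ∈ 𝓘.K n) →
            (∀ n, ∀ x ∈ 𝓘.K n ⊓ 𝓘.Nbar, 𝓘.a⁻¹ * x * 𝓘.a ∈ 𝓘.K n ⊓ 𝓘.Nbar) →
            (∀ n, ∀ x ∈ (cmBorelTriple L 3 v).N, ∃ m : ℕ, ∀ m', m ≤ m' → 𝓘.a ^ m' * x * (𝓘.a ^ m')⁻¹ ∈ 𝓘.K n) →
            (∀ nb ∈ 𝓘.Nbar, ∀ m ∈ (cmBorelTriple L 3 v).M, ∀ n ∈ (cmBorelTriple L 3 v).N, ∀ nb' ∈ 𝓘.Nbar, ∀ m' ∈ (cmBorelTriple L 3 v).M,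
                ∀ n' ∈ (cmBorelTriple L 3 v).N, nb * m * n = nb' * m' * n' → n = n') →
            (∀ n, Pairwise (Function.onFun Disjoint fun m : ℕ =>
                (QuotientGroup.mk : ↥(unitaryGroupOfForm (conjLocal L (IsCMField.complexConj L) v) (cmLocalForm L 3 v)) → ↥(unitaryGroupOfForm (conjLocal L (IsCMField.complexConj L) v) (cmLocalForm L 3 v)) ⧸ Subgroup.center ↥(unitaryGroupOfForm (conjLocal L (IsCMField.complexConj L) v) (cmLocalForm L 3 v))) '' DoubleCoset.doubleCoset (𝓘.a ^ m) (𝓘.K n : Set ↥(unitaryGroupOfForm (conjLocal L (IsCMField.complexConj L) v) (cmLocalForm L 3 v))) (𝓘.K n))) →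
            (∀ k : ↥(unitaryGroupOfForm (conjLocal L (IsCMField.complexConj L) v) (cmLocalForm L 3 v)), k ∈ K₀ ↔ ((((localNonsplitEquiv (IsCMField.complexConj L) (Rogawski1990.qsForm L) (IsCMField.complexConj_ne_one L) w hw) k : ↥(unitaryGroupOfForm (galAdicCompletionMap (L := L) (IsCMField.complexConj L) hw) (placeForm (Rogawski1990.qsForm L) w.1))) : GL (Fin 3) (w.1.adicCompletion L)) ∈ glInt 3 (w.1.adicCompletion L))) →
            ∃ U ∈ 𝓝 (1 : ↥(unitaryGroupOfForm (conjLocal L (IsCMField.complexConj L) v) (cmLocalForm L 3 v))), ∀ n : ℕ, ((𝓘.K n : Set ↥(unitaryGroupOfForm (conjLocal L (IsCMField.complexConj L) v) (cmLocalForm L 3 v))) ⊆ U) → ∀ m : ℕ, 1 ≤ m →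
              ∀ (hbM : z * 𝓘.a ^ m ∈ (cmBorelTriple L 3 v).M) (R : Finset ↥(unitaryGroupOfForm (conjLocal L (IsCMField.complexConj L) v) (cmLocalForm L 3 v))),
                IsLeftTransversal (𝓘.K n) (𝓘.K n ⊓ ConjAct.toConjAct (z * 𝓘.a ^ m) • 𝓘.K n) R →
                ∃ fH : ((UnitaryGroup.cmDatum L 2 (Matrix.of fun i j : Fin 2 => if i.val + j.val + 1 = 2 then (1 : L) else 0)).Local v × (UnitaryGroup.cmDatum L 1 (Matrix.of fun i j : Fin 1 => if i.val + j.val + 1 = 1 then (1 : L) else 0)).Local v) → ℂ, IsLocSmooth fH ∧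
                  IsLocalDeltaTransfer L (qsForm L) v ((finExplicitCollection L (qsForm L) μ (finExplicitDelta_conj_left_all L (qsForm L) μ) (finExplicitDelta_conj_right_all L (qsForm L) μ)) v) mHv mQv fH
                    ((DoubleCoset.doubleCoset (z * 𝓘.a ^ m) (𝓘.K n : Set ↥(unitaryGroupOfForm (conjLocal L (IsCMField.complexConj L) v) (cmLocalForm L 3 v))) (𝓘.K n)).indicator fun _ => (1 : ℂ)) ∧
                  πSt.smoothTrace νHv fH =
                    (νQv.real (𝓘.K n : Set ↥(unitaryGroupOfForm (conjLocal L (IsCMField.complexConj L) v) (cmLocalForm L 3 v))) : ℂ) * (R.card : ℂ) *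
                      ((rootDeltaChar (cmBorelTriple L 3 v).P (Subgroup.inclusion (cmBorelTriple L 3 v).M_le ⟨z * 𝓘.a ^ m, hbM⟩) : ℂˣ) : ℂ) *
                      (((cmXiTorusChar L v (μ.semilocalComponent L v) (torusLocalComponent L (IsCMField.complexConj L) v ξ.η) (torusLocalComponent L (IsCMField.complexConj L) v ξ.ψ)) ⟨z * 𝓘.a ^ m, hbM⟩ : ℂˣ) : ℂ)
 := by
  intro L _ _ _ μ ξ v hns hμu hμω _ _ _ _ νHv νQv _ _ _ _ mHv mQv hcH hcQ hTv π₁ πSt hlab hπ₁ 𝓘 z hzc w hw α hα0 hα1 ha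
    K₀ hK₀c hK₀o hZK₀ hKK₀ hnormK₀ haN haNbar hexh huniq hdisj hK₀E
  -- STEP U: the neighbourhood `U := U_level ∩ U_ξ` (★ G-SHELL-DATA (G2), ★ CharTrivialNhds)
  obtain ⟨r, hr1, U₁, hU₁, hlev⟩ := F0P3cStCharTSGShellData.exists_nhds_one_forall_valued_sub_one_le L v w hw
  -- (R5) device: `χ_ξ` (the XIG value character on the torus) is trivial on `M ∩ U₂`
  haveI : NonarchimedeanGroup ↥(unitaryGroupOfForm (conjLocal L (IsCMField.complexConj L) v) (cmLocalForm L 3 v)) := nonarchimedeanGroup_cmLocal L 3 v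
  haveI : NonarchimedeanGroup ↥(cmBorelTriple L 3 v).M := F0P3cStCharTSXiCont.nonarchimedeanGroup_cmBorelM L v
  obtain ⟨U₂, hU₂, hξ⟩ := F0P3cStCharTSCharTrivialNhds.exists_nhds_forall_subtype_apply_eq_one
    ((cmBorelTriple L 3 v).M)
    (cmXiTorusChar L v (μ.semilocalComponent L v) (torusLocalComponent L (IsCMField.complexConj L) v ξ.η) (torusLocalComponent L (IsCMField.complexConj L) v ξ.ψ))
    (F0P3cStCharTSXiCont.continuousAt_cmXiTorusChar_one L v μ ξ)
  refine ⟨U₁ ∩ U₂, Filter.inter_mem hU₁ hU₂, ?_⟩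
  intro n hKU m hm hbM R hR
  -- (G) shell data of `f = 𝟙_{K_n (z 𝓘.aᵐ) K_n}`
  have hK := hlev (𝓘.K n) (hKU.trans Set.inter_subset_left)
  obtain ⟨β, hzβ, hβ, -⟩ := F0P3cStCharTSGShellData.exists_coe_localNonsplitEquiv_eq_smul_one_of_mem_center L v w hw hzc
  have hf := F0P3cStCharTSHfHonOfSum.tsupport_indicator_doubleCoset_subset (𝓘.isCompact_K n) (𝓘.isCompact_K n) (z * 𝓘.a ^ m) (1 : ℂ)
  -- ═══ (1) `z ∈ M` and the dominance of `b := z·𝓘.aᵐ` at EVERY level (★ CassHTraceKit.dominant_central_mul_pow) ═══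
  have hzM : z ∈ (cmBorelTriple L 3 v).M := by
    have h := (cmBorelTriple L 3 v).M.mul_mem hbM ((cmBorelTriple L 3 v).M.inv_mem ((cmBorelTriple L 3 v).M.pow_mem 𝓘.a_mem m))
    rwa [mul_inv_cancel_right] at h
  obtain ⟨-, hbcomm, hbN, hbNbar, hbexh⟩ :=
    F0P3cStCharTSCassHTraceKit.dominant_central_mul_pow (cmBorelTriple L 3 v) 𝓘 hzc hzM haN haNbar hexh hm
  -- the G-side Weyl data: `w₀ ∈ K₀`, `hKw`, and F1-G's `hiff` at every level (★ K0WeylG ∕ ★ K0WeylGHiff)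
  have hiffG := fun (χ₁ : (LocalRing L v)ˣ →* ℂˣ) (χ₂ : ↥(normOneUnits (conjLocal L (IsCMField.complexConj L) v)) →* ℂˣ) (k : ℕ) =>
    F0P3cStCharTSK0WeylGHiff.hiff_of_iff_glInt L v w hw 𝓘 K₀ hnormK₀ hK₀E χ₁ χ₂ k
  -- ═══ (2) admissibility of the canonical H-family on the G-regular locus (the organ's Borel σ-algebras on the orbit quotients, re-installed locally) ═══
  letI : ∀ a : ((UnitaryGroup.cmDatum L 2 (Matrix.of fun i j : Fin 2 => if i.val + j.val + 1 = 2 then (1 : L) else 0)).Local v ×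
      (UnitaryGroup.cmDatum L 1 (Matrix.of fun i j : Fin 1 => if i.val + j.val + 1 = 1 then (1 : L) else 0)).Local v),
      MeasurableSpace (((UnitaryGroup.cmDatum L 2 (Matrix.of fun i j : Fin 2 => if i.val + j.val + 1 = 2 then (1 : L) else 0)).Local v ×
        (UnitaryGroup.cmDatum L 1 (Matrix.of fun i j : Fin 1 => if i.val + j.val + 1 = 1 then (1 : L) else 0)).Local v) ⧸
        Subgroup.centralizer ({a} : Set (((UnitaryGroup.cmDatum L 2 (Matrix.of fun i j : Fin 2 => if i.val + j.val + 1 = 2 then (1 : L) else 0)).Local v ×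
          (UnitaryGroup.cmDatum L 1 (Matrix.of fun i j : Fin 1 => if i.val + j.val + 1 = 1 then (1 : L) else 0)).Local v)))) := fun _ => borel _
  haveI : ∀ a : ((UnitaryGroup.cmDatum L 2 (Matrix.of fun i j : Fin 2 => if i.val + j.val + 1 = 2 then (1 : L) else 0)).Local v ×
      (UnitaryGroup.cmDatum L 1 (Matrix.of fun i j : Fin 1 => if i.val + j.val + 1 = 1 then (1 : L) else 0)).Local v),
      BorelSpace (((UnitaryGroup.cmDatum L 2 (Matrix.of fun i j : Fin 2 => if i.val + j.val + 1 = 2 then (1 : L) else 0)).Local v ×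
        (UnitaryGroup.cmDatum L 1 (Matrix.of fun i j : Fin 1 => if i.val + j.val + 1 = 1 then (1 : L) else 0)).Local v) ⧸
        Subgroup.centralizer ({a} : Set (((UnitaryGroup.cmDatum L 2 (Matrix.of fun i j : Fin 2 => if i.val + j.val + 1 = 2 then (1 : L) else 0)).Local v ×
          (UnitaryGroup.cmDatum L 1 (Matrix.of fun i j : Fin 1 => if i.val + j.val + 1 = 1 then (1 : L) else 0)).Local v)))) := fun _ => ⟨rfl⟩
  letI : ∀ γ : Gqs L v, MeasurableSpace (Gqs L v ⧸ Subgroup.centralizer ({γ} : Set (Gqs L v))) := fun _ => borel _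
  haveI : ∀ γ : Gqs L v, BorelSpace (Gqs L v ⧸ Subgroup.centralizer ({γ} : Set (Gqs L v))) := fun _ => ⟨rfl⟩
  have hmH : mHv.IsAdmissibleOn (IsLocalGRegular L v) := hcH.isAdmissibleOn
  have hmQ : mQv.IsAdmissibleOn (fun γ => IsRegularElt (γ.val : GL (Fin 3) (UnitaryGroup.LocalRing L v))) := hcQ.isAdmissibleOn
  -- ═══ (3) the H-datum along the ray `d(α, (σ_w α)⁻¹)` (★ A2Ray → ★ U2 Inst), its Weyl data and general dominance ═══
  obtain ⟨a₂, ha₂⟩ := F0P3cStCharTSA2Ray.exists_torus_coe_localNonsplitEquiv_eq_diagonal_two L v w hw hα0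
  obtain ⟨𝓘₂, K₀₂, ha𝓘₂, hK₀₂c, hK₀₂o, hZ₂, hKle₂, hKK₀₂, haN₂, haNbar₂, hexh₂, hinj₂, hK₀E₂, hK₂, hNbar₂⟩ :=
    F0P3cCMBorelIwahoriDatumU2.exists_cmIwahoriDatum₂ L v w hw
      (a₂ : ↥(unitaryGroupOfForm (conjLocal L (IsCMField.complexConj L) v) (cmLocalForm L 2 v))) hα0 hα1 ha₂
  obtain ⟨w₂, hw₂, hw₂K, hKw₂⟩ :=
    F0P3cStCharTSK0WeylG.exists_weylElt_mem_and_forall_mul_mul_inv_mem_two L v w hw hns 𝓘₂ K₀₂ hKK₀₂ hK₀E₂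
  -- F1-H's dominance tuple `hbN ∧ hbNbar ∧ hbexh ∧ ∃ R₂` at EVERY H-dominant `t` (`E₂ t = diag(e₀,e₁)`, `|e₀| < |e₁|`) and every H-level
  have hdomH := fun (n₂ : ℕ) (t : ↥(unitaryGroupOfForm (conjLocal L (IsCMField.complexConj L) v) (cmLocalForm L 2 v)))
      (e₀ e₁ : w.1.adicCompletion L)
      (ht : ((((localNonsplitEquiv (IsCMField.complexConj L) (Matrix.of fun i j : Fin 2 => if i.val + j.val + 1 = 2 then (1 : L) else 0)
          (IsCMField.complexConj_ne_one L) w hw) t :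
        ↥(unitaryGroupOfForm (galAdicCompletionMap (L := L) (IsCMField.complexConj L) hw)
          (placeForm (Matrix.of fun i j : Fin 2 => if i.val + j.val + 1 = 2 then (1 : L) else 0) w.1))) :
        GL (Fin 2) (w.1.adicCompletion L)) : Matrix (Fin 2) (Fin 2) (w.1.adicCompletion L)) = Matrix.diagonal ![e₀, e₁])
      (hlt : Valued.v e₀ < Valued.v e₁) =>
    F0P3cStCharTSDomGeneralHPkg.domGeneralH_of_inst L v w hw hα0 hα1 𝓘₂ hK₂ hNbar₂ n₂ t ht hlt
  -- ═══ (4) the μ-level `nμ` (★ HTAU-ON-COSET) and the H-level pick `(n′, K₁)` (★ LEVEL-PICK-INST); `S′ := (𝓘₂.K n′ ∩ T₂) × K₁` ═══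
  obtain ⟨nμ, hτμ⟩ := F0P3cStCharTSHtauOnCoset.exists_level_hτ_of_smul_cosets.{0} L v w hw μ  -- index universe pinned to `Type` (the cover `F` indexes by `T₂ × U₁`)
  obtain ⟨n₀', K₁₀, hK₁₀o, hK₁₀c, hboxpick⟩ := F0P3cStCharTSLevelPickInst.exists_level_K₁_box_pick_subgroup L v 𝓘 n 𝓘₂ nμ
  -- (J3) «H-LEVEL-DEEP» (★ p850484): deepen `(n′₀, K₁₀)` to `(n′, K₁)` so that `ξ_v = 1` on `K_{2,n′} × K₁` (`hlevH`), `ψ_v∘det = 1` on `K₁` (`hK₁χ`), `χ_{H,2} = 1` on `T₂ ∩ K_{2,n′}` (`hχlev`)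
  have hψo := F0P3cStCharTSValueAtFlips.isOpen_ker_psi_comp_localDet L v ξ.ψ
  obtain ⟨n', K₁, hKle, hK₁le, hK₁o, hK₁c, hlevH, hK₁χ, hχlev⟩ :=
    F0P3cStCharTSHLevelDeep.exists_deep_level_cm L v ξ 𝓘₂ n₀' K₁₀ hK₁₀o hK₁₀c hψo
  set S' : Subgroup (↥(cmBorelTriple L 2 v).M ×
      (cmDatum L 1 (Matrix.of fun i j : Fin 1 => if i.val + j.val + 1 = 1 then (1 : L) else 0)).Local v) :=
    ((𝓘₂.K n').comap (cmBorelTriple L 2 v).M.subtype).prod K₁ with hS'def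
  have hS'mem : ∀ k ∈ S', (k.1 : ↥(unitaryGroupOfForm (conjLocal L (IsCMField.complexConj L) v) (cmLocalForm L 2 v))) ∈ 𝓘₂.K n' ∧ k.2 ∈ K₁ :=
    fun k hk => Subgroup.mem_prod.1 hk
  have hS'o : IsOpen (S' : Set (↥(cmBorelTriple L 2 v).M ×
      (cmDatum L 1 (Matrix.of fun i j : Fin 1 => if i.val + j.val + 1 = 1 then (1 : L) else 0)).Local v)) := by
    rw [hS'def, Subgroup.coe_prod]
    exact ((𝓘₂.isOpen_K n').preimage continuous_subtype_val).prod hK₁o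
  obtain ⟨hbox, hpick⟩ := hboxpick S' (F0P3cStCharTSHLevelDeep.forall_mem_of_refine (cmBorelTriple L 2 v) 𝓘₂ hKle hK₁le S' hS'mem)
  -- `hτ` at the μ-level for THIS `S′` is `hτμ S' hbox (s := F) (u := …)` (KIT-B's clause; the index type is fixed at the call site)
  -- ═══ (5) XIG-DATA: the G-Weyl element `w₀ ∈ K₀` with `hKw`, the oriented base `b′ = ʷ(z aᵐ)`, the shell group `Sn`, the cover `F` ═══
  obtain ⟨w₀, b', Sn, F, hw₀, hw₀K, hKw, hb', hb'E, hb'lt, hSn, hSnc, hSnK, hΨ, hF₁, hF₂, hF₃, hF₄⟩ :=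
    F0P3cStCharTSXIGData.exists_xigData L v w hw hns 𝓘 n K₀ hnormK₀ hK₀E hzβ hβ ha hα0 hα1 hm hbM S' hS'o hpick
  -- (5b) the representatives are hlevi-ORIENTED hyperbolic (★ REP-HYPERBOLIC p850107)
  have hrepH := F0P3cStCharTSRepHyperbolic.forall_rep_hyperbolic_of_cover L v w hw (𝓘.K n) hr1 hK hb'E hb'lt Sn hSnK F hF₁
  -- (5c) the `H`-level bound in the `E₂`-reading: the U2-Inst datum is a principal-congruence comap (`hK₂`), level `|α|^{n′+1} < 1`
  have hr2 : Valued.v α ^ (n' + 1) < 1 := pow_lt_one₀ zero_le hα1 (Nat.succ_ne_zero n')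
  have hK₂lev : ∀ k ∈ 𝓘₂.K n', ∀ i j, Valued.v ((((localNonsplitEquiv (IsCMField.complexConj L) (Matrix.of fun i j : Fin 2 => if i.val + j.val + 1 = 2 then (1 : L) else 0)
        (IsCMField.complexConj_ne_one L) w hw k :
        ↥(unitaryGroupOfForm (galAdicCompletionMap (L := L) (IsCMField.complexConj L) hw) (placeForm (Matrix.of fun i j : Fin 2 => if i.val + j.val + 1 = 2 then (1 : L) else 0) w.1))) :
        GL (Fin 2) (w.1.adicCompletion L)) : Matrix (Fin 2) (Fin 2) (w.1.adicCompletion L)) i j - (1 : Matrix (Fin 2) (Fin 2) (w.1.adicCompletion L)) i j) ≤ Valued.v α ^ (n' + 1) := by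
    intro k hk i j
    have hk' : ((localNonsplitEquiv (IsCMField.complexConj L) (Matrix.of fun i j : Fin 2 => if i.val + j.val + 1 = 2 then (1 : L) else 0)
        (IsCMField.complexConj_ne_one L) w hw k :
        ↥(unitaryGroupOfForm (galAdicCompletionMap (L := L) (IsCMField.complexConj L) hw) (placeForm (Matrix.of fun i j : Fin 2 => if i.val + j.val + 1 = 2 then (1 : L) else 0) w.1))) :
        GL (Fin 2) (w.1.adicCompletion L)) ∈ congruenceGL 2 (ValuativeRel.valuation (w.1.adicCompletion L) α ^ (n' + 1)) := by
      have h0 := hk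
      rw [hK₂ n'] at h0
      exact h0
    have h := hk'.2.1 i j
    rw [Matrix.sub_apply, ← map_pow] at h
    rw [← map_pow, v_le_iff_valuation_le]
    simpa using h
  -- `↑Sn` as a set, in the two spellings the bricks print
  have hSnset : (Sn : Set ↥(cmBorelTriple L 3 v).M) =
      {k : ↥(cmBorelTriple L 3 v).M | (k : ↥(unitaryGroupOfForm (conjLocal L (IsCMField.complexConj L) v) (cmLocalForm L 3 v))) ∈ 𝓘.K n} := by
    ext k; rw [hSn]; simp [Subgroup.mem_subgroupOf]
  have hSncoe : (((𝓘.K n).comap (cmBorelTriple L 3 v).M.subtype : Subgroup ↥(cmBorelTriple L 3 v).M) : Set ↥(cmBorelTriple L 3 v).M) = ↑Sn := by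
    rw [hSn]; rfl
  have hb'pt : (⟨w₀ * (z * 𝓘.a ^ m) * w₀⁻¹, weylConj_mem_cmTorus L v w₀ hw₀ (⟨z * 𝓘.a ^ m, hbM⟩ : ↥(cmBorelTriple L 3 v).M)⟩ : ↥(cmBorelTriple L 3 v).M) = b' :=
    Subtype.ext hb'.symm
  -- the H-shell level `K_H := 𝓘₂.K n′ × K₁` (compact open; `↑(H.prod K) = ↑H ×ˢ ↑K` definitionally)
  set KH : Subgroup (↥(unitaryGroupOfForm (conjLocal L (IsCMField.complexConj L) v) (cmLocalForm L 2 v)) ×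
      (UnitaryGroup.cmDatum L 1 (Matrix.of fun i j : Fin 1 => if i.val + j.val + 1 = 1 then (1 : L) else 0)).Local v) :=
    (𝓘₂.K n').prod K₁ with hKHdef
  have hKHo : IsOpen (SetLike.coe KH) := (𝓘₂.isOpen_K n').prod hK₁o
  have hKHc : IsCompact (SetLike.coe KH) := (𝓘₂.isCompact_K n').prod hK₁c
  -- ═══ (6) the refined H-test function `fH₀ := ∑ u ∈ F, cj u • 𝟙_{K_H (↑u.1,u.2) K_H}` and the three conjuncts ═══
  classical
  -- index = the cover `F ⊆ T₂ × U₁` itself; representatives `rep u := (↑u.1, u.2) ∈ X_H`; summands `g u := 𝟙_{K_H · rep u · K_H}`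
  set rep : (↥(cmBorelTriple L 2 v).M × (UnitaryGroup.cmDatum L 1 (Matrix.of fun i j : Fin 1 => if i.val + j.val + 1 = 1 then (1 : L) else 0)).Local v) → (↥(unitaryGroupOfForm (conjLocal L (IsCMField.complexConj L) v) (cmLocalForm L 2 v)) × (UnitaryGroup.cmDatum L 1 (Matrix.of fun i j : Fin 1 => if i.val + j.val + 1 = 1 then (1 : L) else 0)).Local v) := fun u => ((u.1 : ↥(unitaryGroupOfForm (conjLocal L (IsCMField.complexConj L) v) (cmLocalForm L 2 v))), u.2) with hrep
  set g : (↥(cmBorelTriple L 2 v).M × (UnitaryGroup.cmDatum L 1 (Matrix.of fun i j : Fin 1 => if i.val + j.val + 1 = 1 then (1 : L) else 0)).Local v) → (↥(unitaryGroupOfForm (conjLocal L (IsCMField.complexConj L) v) (cmLocalForm L 2 v)) × (UnitaryGroup.cmDatum L 1 (Matrix.of fun i j : Fin 1 => if i.val + j.val + 1 = 1 then (1 : L) else 0)).Local v) → ℂ :=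
    fun u => (DoubleCoset.doubleCoset (rep u) (SetLike.coe KH) (SetLike.coe KH)).indicator fun _ => (1 : ℂ) with hgdef
  have hg : ∀ u ∈ F, IsLocSmooth (g u) := fun u _ =>
    isLocSmooth_indicator_of_isOpen_isCompact (F0P3cStCharTSGShellData.isOpen_doubleCoset' KH KH hKHo (rep u))
      (F0P3cStCharTSHfHonOfSum.isCompact_doubleCoset hKHc hKHc (rep u))
  -- KIT-B's coset data from XIG-DATA: `C u := u • S′`, `τ u := finTau(rep u)`, `B₂ := b′ • S_n`; (hC) (hcov) (hsub) (hτ) are ★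
  set C : (↥(cmBorelTriple L 2 v).M × (UnitaryGroup.cmDatum L 1 (Matrix.of fun i j : Fin 1 => if i.val + j.val + 1 = 1 then (1 : L) else 0)).Local v) → Set (↥(cmBorelTriple L 2 v).M × (UnitaryGroup.cmDatum L 1 (Matrix.of fun i j : Fin 1 => if i.val + j.val + 1 = 1 then (1 : L) else 0)).Local v) := fun u => u • (S' : Set (↥(cmBorelTriple L 2 v).M × (UnitaryGroup.cmDatum L 1 (Matrix.of fun i j : Fin 1 => if i.val + j.val + 1 = 1 then (1 : L) else 0)).Local v)) with hCdef
  set τ : (↥(cmBorelTriple L 2 v).M × (UnitaryGroup.cmDatum L 1 (Matrix.of fun i j : Fin 1 => if i.val + j.val + 1 = 1 then (1 : L) else 0)).Local v) → ℂ := fun u => finTau L v (rep u) μ with hτdef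
  set B₂ : Set ↥(cmBorelTriple L 3 v).M := b' • (Sn : Set ↥(cmBorelTriple L 3 v).M) with hB₂def
  have hC : (↑F : Set (↥(cmBorelTriple L 2 v).M × (UnitaryGroup.cmDatum L 1 (Matrix.of fun i j : Fin 1 => if i.val + j.val + 1 = 1 then (1 : L) else 0)).Local v)).PairwiseDisjoint C := hF₂
  -- ═══ (6a) ① the `G`-side closed form (★ HOG-OF-GVALUE p850178) on a Haar measure `μT` of `T₃`: letters `κG`, `κ := 1`, `B₁ := b•Sn`, `B₂ := b′•Sn` ═══
  haveI : LocallyCompactSpace ↥(unitaryGroupOfForm (conjLocal L (IsCMField.complexConj L) v) (cmLocalForm L 3 v)) :=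
    locallyCompactSpace_local (IsCMField.complexConj L) 3 _ v
  haveI := locallyCompactSpace_cmBorelU L 3 v
  -- the organ's σ-algebra on `Gqs L v`, re-read on the `U(Φ₃)`-spelling of the same type (one σ-algebra, two names)
  letI : MeasurableSpace ↥(unitaryGroupOfForm (conjLocal L (IsCMField.complexConj L) v) (cmLocalForm L 3 v)) := ‹MeasurableSpace (Gqs L v)›
  haveI : BorelSpace ↥(unitaryGroupOfForm (conjLocal L (IsCMField.complexConj L) v) (cmLocalForm L 3 v)) := ‹BorelSpace (Gqs L v)›
  haveI : LocallyCompactSpace ↥(cmBorelTriple L 3 v).M := (isClosed_cmBorelTriple_M L v).isClosedEmbedding_subtypeVal.locallyCompactSpace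
  obtain ⟨db, hdb, -, -, -, hb01, hb12⟩ := F0P3cStCharTSHKSpellings.exists_glDiagonal_shellPoint L v w hw hzβ hβ ha hα0 hα1 hm hbM
  have hOG₀ := F0P3cStCharTSHogOfGValue.hOG_indicator_shell L hns w hw νQv hcQ (Measure.haar : Measure ↥(cmBorelTriple L 3 v).M) 𝓘 n (𝓘.isOpen_K n) (𝓘.isCompact_K n) hr1
    (F0P3cStCharTSHKSpellings.hKr_of_hK L v w hw (𝓘.K n) hK) w₀ hw₀ (hKw n) hbM (hbN n) (hbNbar n) (hbexh n) hR hdb hb01 hb12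
  rw [F0P3cStCharTSHogOfGValue.setOf_inv_mul_mem_eq_smul, F0P3cStCharTSHogOfGValue.setOf_inv_mul_mem_eq_smul, hSncoe, hb'pt] at hOG₀
  obtain ⟨κG, hκGdef⟩ : ∃ κG : ℂ, κG = ((((((νQv.map (cmDatumLocalCongr L v (1 : GL (Fin 3) (LocalRing L v)) isUnit_one (F0P3cStCharTSDeltaAtLevi.formCongr_one_qsForm L v)).symm : Measure ↥(unitaryGroupOfForm (conjLocal L (IsCMField.complexConj L) v) (cmLocalForm L 3 v))))).real ((𝓘.K n) : Set ↥(unitaryGroupOfForm (conjLocal L (IsCMField.complexConj L) v) (cmLocalForm L 3 v))) : ℂ) * (R.card : ℂ) * ((rootDeltaChar (cmBorelTriple L 3 v).P (Subgroup.inclusion (cmBorelTriple L 3 v).M_le (⟨z * 𝓘.a ^ m, hbM⟩ : ↥(cmBorelTriple L 3 v).M)) : ℂˣ) : ℂ)) * (((Measure.haar : Measure ↥(cmBorelTriple L 3 v).M).real {t : ↥(cmBorelTriple L 3 v).M | (t : ↥(unitaryGroupOfForm (conjLocal L (IsCMField.complexConj L) v) (cmLocalForm L 3 v))) ∈ cmLocalIntegralLevel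 L 3 (Matrix.of fun i j : Fin 3 => if i.val + j.val + 1 = 3 then (1 : L) else 0) v} : ℝ) : ℂ)) / (((Measure.haar : Measure ↥(cmBorelTriple L 3 v).M).real (Sn : Set ↥(cmBorelTriple L 3 v).M) : ℝ) : ℂ) := ⟨_, rfl⟩
  -- ═══ (6b) ② the `H`-PACKAGE (p850442 `hPackageH`): transversals `R₂`, letters `κH κ′ C′`, the (OH) clause, `κH ≠ 0`, `C′ u = u♭ • S′`, `κ′ = 1`, closed form ═══
  letI : MeasurableSpace ↥(unitaryGroupOfForm (conjLocal L (IsCMField.complexConj L) v) (cmLocalForm L 2 v)) := borel _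
  haveI : BorelSpace ↥(unitaryGroupOfForm (conjLocal L (IsCMField.complexConj L) v) (cmLocalForm L 2 v)) := ⟨rfl⟩
  letI : MeasurableSpace ((UnitaryGroup.cmDatum L 1 (Matrix.of fun i j : Fin 1 => if i.val + j.val + 1 = 1 then (1 : L) else 0)).Local v) := borel _
  haveI : BorelSpace ((UnitaryGroup.cmDatum L 1 (Matrix.of fun i j : Fin 1 => if i.val + j.val + 1 = 1 then (1 : L) else 0)).Local v) := ⟨rfl⟩
  haveI : LocallyCompactSpace ↥(unitaryGroupOfForm (conjLocal L (IsCMField.complexConj L) v) (cmLocalForm L 2 v)) := locallyCompactSpace_local (IsCMField.complexConj L) 2 _ v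
  haveI : T1Space (LocalRing L v) := inferInstance
  haveI : LocallyCompactSpace ↥(cmBorelTriple L 2 v).M :=
    (isClosed_torusU_of_t1Space (conjLocal L (IsCMField.complexConj L) v) (cmLocalForm L 2 v)).isClosedEmbedding_subtypeVal.locallyCompactSpace
  have hrepF : ∀ u ∈ F, ∃ d' : Fin 2 → (LocalRing L v)ˣ,
      glDiagonal 2 (LocalRing L v) d' = ((u.1 : ↥(unitaryGroupOfForm (conjLocal L (IsCMField.complexConj L) v) (cmLocalForm L 2 v))) : GL (Fin 2) (LocalRing L v)) ∧
      Valued.v (((d' 1 : (LocalRing L v)ˣ) : LocalRing L v) w) < Valued.v (((d' 0 : (LocalRing L v)ˣ) : LocalRing L v) w) := fun u hu => by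
    obtain ⟨⟨d', hd', hlt, -⟩, -, -⟩ := hrepH u hu
    exact ⟨d', hd', hlt⟩
  obtain ⟨R₂, κH, κ', C', hR₂, hOHj', hκH, hC', hκ'1, hκHform⟩ :=
    F0P3cStCharTSXIGHPackage.hPackageH L v w hw νHv hcH (Measure.haar : Measure ↥(cmBorelTriple L 2 v).M) 𝓘₂ n' K₁ hK₁o hK₁c
      w₂ hw₂ (hKw₂ n') F hns hα0 hα1 hK₂ hNbar₂ hrepF
  -- the coefficients `cj u := τ u · (κG κ) ∕ κH u` (★ CONSTANTS `hval_of_div`)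
  set cj : (↥(cmBorelTriple L 2 v).M × (UnitaryGroup.cmDatum L 1 (Matrix.of fun i j : Fin 1 => if i.val + j.val + 1 = 1 then (1 : L) else 0)).Local v) → ℂ := fun u => τ u * (κG * 1) / κH u with hcjdef
  have hval : ∀ u ∈ F, cj u * κH u = τ u * (κG * 1) := F0P3cStCharTSConstants.hval_of_div F τ κH (κG * 1) hκH
  refine ⟨∑ u ∈ F, cj u • g u, F0P3cStCharTSTestFunctionSum.isLocSmooth_doubleCosetSum hKHo hKHc F cj rep, ?transfer, ?value⟩
  case transfer =>
    refine F0P3cStCharTSTransferChecklist.isLocalDeltaTransfer_doubleCosetSum_of_checklist L v w hw μ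
      (finExplicitDelta_conj_left_all L (qsForm L) μ) (finExplicitDelta_conj_right_all L (qsForm L) μ) hmH mQv (𝓘.K n) hr1 hK hzβ hβ ha hα0 hα1 hm
      _ hf F cj g hg ?hfHon ((⟨z * 𝓘.a ^ m, hbM⟩ : ↥(cmBorelTriple L 3 v).M) • (Sn : Set ↥(cmBorelTriple L 3 v).M)) B₂ κG 1 ?hOG C C' κH κ' ?hOHj τ hC ?horient ?hflip ?hcov ?hsub ?hτ hval
    case hfHon =>
      exact F0P3cStCharTSHfHonOfFH0.hfHon_fH0 L v w hw 𝓘₂ n' K₁ hK₁o hr2 hK₂lev F cj fun u hu => by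
        obtain ⟨d₀, d₁, h1, h2, h3, -⟩ := (hrepH u hu).2.1
        exact ⟨d₀, d₁, h1, h2.ne', h3⟩
    case hOG =>
      intro γH d' hd' hreg hlt h01 t ht hd ha' hb''
      subst hκGdef
      exact hOG₀ γH d' hd' hreg hlt h01 t ht hd ha' hb''
    case hOHj => exact hOHj'
    case horient =>
      intro γH d' hd' hreg hlt h01 t ht
      have h := F0P3cStCharTSHorient.horient_antiShell L v w hw (𝓘.K n) hr1 hK hzβ hβ ha hα0 hα1 hm hbM γH d' hd' hreg hlt h01 t ht
      rw [F0P3cStCharTSHogOfGValue.setOf_inv_mul_mem_eq_smul, ← hSnset] at h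
      exact h
    case hflip =>
      refine F0P3cStCharTSShellOn.hflip_of_antiOriented L v w hw F
        (fun u => (((⟨w₂ * (u.1 : ↥(unitaryGroupOfForm (conjLocal L (IsCMField.complexConj L) v) (cmLocalForm L 2 v))) * w₂⁻¹, weylConj_mem_cmTorus_two L v w₂ hw₂ u.1⟩ : ↥(cmBorelTriple L 2 v).M), u.2) : (↥(cmBorelTriple L 2 v).M × ((UnitaryGroup.cmDatum L 1 (Matrix.of fun i j : Fin 1 => if i.val + j.val + 1 = 1 then (1 : L) else 0)).Local v))))
        S' C' hC' ?_ ?_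
      · intro u hu e he
        obtain ⟨⟨d', hd', hlt, -⟩, -, -⟩ := hrepH u hu
        obtain ⟨hmem, d'', hd'', hlt'', -⟩ := F0P3cStCharTSFlipDominant.exists_glDiagonal_weylConj_of_oriented L v w hw hw₂ u.1 hd' hlt
        have h1 := F0P3cStCharTSRepHyperbolic.localNonsplitEquiv_two_eq_diagonal_of_glDiagonal_eq L v w hw
          (⟨w₂ * (u.1 : ↥(unitaryGroupOfForm (conjLocal L (IsCMField.complexConj L) v) (cmLocalForm L 2 v))) * w₂⁻¹, weylConj_mem_cmTorus_two L v w₂ hw₂ u.1⟩ : ↥(cmBorelTriple L 2 v).M) he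
        have h2 := F0P3cStCharTSRepHyperbolic.localNonsplitEquiv_two_eq_diagonal_of_glDiagonal_eq L v w hw
          (⟨w₂ * (u.1 : ↥(unitaryGroupOfForm (conjLocal L (IsCMField.complexConj L) v) (cmLocalForm L 2 v))) * w₂⁻¹, weylConj_mem_cmTorus_two L v w₂ hw₂ u.1⟩ : ↥(cmBorelTriple L 2 v).M) hd''
        rw [h1] at h2
        have h0 := congrFun (Matrix.diagonal_injective h2) 0
        have h1' := congrFun (Matrix.diagonal_injective h2) 1
        simp only [Matrix.cons_val_zero, Matrix.cons_val_one] at h0 h1'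
        rw [h0, h1']
        exact hlt''
      · intro k hk e he i
        have hE := F0P3cStCharTSRepHyperbolic.localNonsplitEquiv_two_eq_diagonal_of_glDiagonal_eq L v w hw k.1 he
        have hb := hK₂lev _ (hS'mem k hk).1 i i
        rw [hE, Matrix.diagonal_apply_eq, Matrix.one_apply_eq] at hb
        fin_cases i
        · simpa using hb.trans_lt hr2
        · simpa using hb.trans_lt hr2
    case hcov =>
      intro γH d' _ _ _ _ tH htH t ht hB₂
      have hx : (t : ↥(unitaryGroupOfForm (conjLocal L (IsCMField.complexConj L) v) (cmLocalForm L 3 v))) =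
          endoEmbLocal L v ((tH : ↥(unitaryGroupOfForm (conjLocal L (IsCMField.complexConj L) v) (cmLocalForm L 2 v))), γH.2) := by
        rw [ht, htH, Prod.mk.eta]
      exact (hF₄ (tH, γH.2) t hx).1 hB₂
    case hsub =>
      intro γH d' _ _ _ _ tH htH t ht u hu hx
      have hx' : (t : ↥(unitaryGroupOfForm (conjLocal L (IsCMField.complexConj L) v) (cmLocalForm L 3 v))) =
          endoEmbLocal L v ((tH : ↥(unitaryGroupOfForm (conjLocal L (IsCMField.complexConj L) v) (cmLocalForm L 2 v))), γH.2) := by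
        rw [ht, htH, Prod.mk.eta]
      exact (hF₄ (tH, γH.2) t hx').2 ⟨u, hu, hx⟩
    case hτ =>
      intro γH d' hd' hreg hlt h01 tH htH u hu hx
      exact hτμ S' hbox F (fun u => u) γH d' hd' hreg hlt h01 tH htH u hu hx
  case value =>
    -- ═══ (δ₄) THE VALUE CONJUNCT (LH6-p02 (g3)): ★ VALUE-RATIOS p850493 + ★ VALUE-AT-FLIPS p850420 over ★ HTR-AT-REPS p850360, ★ FLIP-REP p850337, (J1)(J2) ★ p850484 ═══
    -- (V0) (J1) the normalised Jacquet datum of `i_H(χ_{H,2})` (★ W2-c) and (J2) F1-H's `hiff` at `χ_{H,2}` for `𝓘₂` (★ p850484)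
    obtain ⟨hfd, h2J, ℓ, hℓ1, hL, hQ⟩ := F0P3cU2PrincipalSeriesJacquetFiltration.u2PrincipalSeries_jacquetFiltration (L := L) v hns _ _
      (F0P3cStCharTSHLevelDeep.continuous_chiH2_fst L v ξ) (continuous_torusLocalComponent L (IsCMField.complexConj L) (v := v) ξ.ψ)
    have hiffH := F0P3cStCharTSHLevelDeep.hiff_chiH2 L v ξ 𝓘₂ hw₂ hKK₀₂ hw₂K n'
    -- (V1) F1-H dominance at the flipped reps `ʷu₁` (★ DOM-GENERAL-H pkg at `E₂(ʷu₁) = diag(d′₁, d′₀)`, ★ FLIP-DOMINANT)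
    have hdom := fun u (hu : u ∈ F) =>
      hdomH n' (w₂ * (u.1 : ↥(unitaryGroupOfForm (conjLocal L (IsCMField.complexConj L) v) (cmLocalForm L 2 v))) * w₂⁻¹) _ _
        (F0P3cStCharTSFlipDominant.localNonsplitEquiv_two_weylConj_eq_diagonal L v w hw hw₂ u.1 (hrepH u hu).1.choose_spec.1)
        (hrepH u hu).1.choose_spec.2.1
    -- (V2) the Haar measure of `H_v` is a product: σ-algebra (★ `measurableSpace_cmH_eq_prod`) and `νHv = ν₂ ⊗ ν₁` (★ `exists_haar_prod_eq_cmH`)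
    letI : MeasurableSpace ((UnitaryGroup.cmDatum L 2 (Matrix.of fun i j : Fin 2 => if i.val + j.val + 1 = 2 then (1 : L) else 0)).Local v) := borel _
    haveI : BorelSpace ((UnitaryGroup.cmDatum L 2 (Matrix.of fun i j : Fin 2 => if i.val + j.val + 1 = 2 then (1 : L) else 0)).Local v) := ⟨rfl⟩
    have hmH := F0P3cStCharTSHaarProdSplit.measurableSpace_cmH_eq_prod L v ‹MeasurableSpace (((UnitaryGroup.cmDatum L 2 (Matrix.of fun i j : Fin 2 => if i.val + j.val + 1 = 2 then (1 : L) else 0)).Local v) × ((UnitaryGroup.cmDatum L 1 (Matrix.of fun i j : Fin 1 => if i.val + j.val + 1 = 1 then (1 : L) else 0)).Local v))›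
    subst hmH
    obtain ⟨ν₂, ν₁, hν₂, hν₂r, hν₁, hν₁r, hprod⟩ := F0P3cStCharTSHaarProdSplit.exists_haar_prod_eq_cmH L v w hw νHv
    subst hprod
    haveI := hν₂; haveI := hν₂r; haveI := hν₁; haveI := hν₁r
    -- (V3) the four measure-side inputs (★ VALUE-RATIOS) at `μT := haar(T₃)`, `μT₂ := haar(T₂)`, `δ₃ := δ_B^{1∕2}(z aᵐ)`
    obtain ⟨rG, rH, hAG, hAH, hrH, hcard⟩ := F0P3cStCharTSValueRatios.exists_value_ratios L v w hw (ν₂.prod ν₁) ν₂ ν₁ rfl νQv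
      (Measure.haar : Measure ↥(cmBorelTriple L 3 v).M) (Measure.haar : Measure ↥(cmBorelTriple L 2 v).M) 𝓘 n Sn hSn b' R
      (((rootDeltaChar (cmBorelTriple L 3 v).P (Subgroup.inclusion (cmBorelTriple L 3 v).M_le (⟨z * 𝓘.a ^ m, hbM⟩ : ↥(cmBorelTriple L 3 v).M)) : ℂˣ) : ℂ))
      𝓘₂ n' K₁ hK₁o hK₁c w₂ hw₂ R₂ F hF₃ hF₂
    -- (V4) (R5) on `S_n ⊆ K_n ⊆ U₂`, ★ FLIP-REP at the flips, ★ HTR-AT-REPS per summand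
    have hSnχ : ∀ t ∈ Sn, cmXiTorusChar L v (μ.semilocalComponent L v) (torusLocalComponent L (IsCMField.complexConj L) v ξ.η)
        (torusLocalComponent L (IsCMField.complexConj L) v ξ.ψ) t = 1 :=
      fun t ht => hξ t (hKU (hSnK t ht)).2
    have hrepflip := F0P3cStCharTSXIGDataFlip.forall_exists_mem_smul_flip_of_cover L v 𝓘 n w₀ hw₀ (hKw n) w₂ hw₂ hbM b' hb' Sn hSn F hF₁
    have htrI := F0P3cStCharTSHtrAtReps.htr_at_reps L v hns ν₂ ν₁ ξ π₁ πSt hlab hπ₁ hψo 𝓘₂ n' K₁ hK₁o hK₁c hK₁χ hlevH hχlev w₂ hw₂ (hKw₂ n') F hdom R₂ hR₂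
      hfd h2J ℓ hℓ1 hL hQ hiffH
    -- (V5) the VALUE third
    haveI := locallyCompactSpace_cmBorelU L 2 v
    exact F0P3cStCharTSValueAtFlips.smoothTrace_fH0_eq_mul_cmXiTorusChar_of_oriented L v w hw (ν₂.prod ν₁) hns ξ π₁ πSt hlab hπ₁ μ hμω 𝓘₂ n' K₁ hK₁o hK₁c
      w₂ hw₂ F hrepH Sn hSnχ ⟨z * 𝓘.a ^ m, hbM⟩ hrepflip cj κH
      (fun u => (ν₂.real (𝓘₂.K n' : Set ↥(unitaryGroupOfForm (conjLocal L (IsCMField.complexConj L) v) (cmLocalForm L 2 v))) : ℂ) * ((R₂ u).card : ℂ) *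
        (ν₁.real (K₁ : Set ((UnitaryGroup.cmDatum L 1 (Matrix.of fun i j : Fin 1 => if i.val + j.val + 1 = 1 then (1 : L) else 0)).Local v)) : ℂ) *
        (((rootDeltaChar (cmBorelTriple L 2 v).P (Subgroup.inclusion (cmBorelTriple L 2 v).M_le
          ⟨(w₂ * (u.1 : ↥(unitaryGroupOfForm (conjLocal L (IsCMField.complexConj L) v) (cmLocalForm L 2 v))) * w₂⁻¹), (weylConj_mem_cmTorus_two L v w₂ hw₂ u.1)⟩)) : ℂˣ) : ℂ))
      κG 1 _ rG rH hval (fun u hu => (hκHform u hu).trans (hAH u hu)) (by rw [hκGdef]; exact hAG) hrH hcard htrI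

end Summit.HodgeConjecture.HodgeConjecture.Cruxes.H413.F0P3cStCharTSXIGAssembly

end
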